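import Literature.Geometry.Lorentzian.TameBreathingCurve
import Literature.Geometry.Lorentzian.TameFamilyFarSurgery
import Literature.Geometry.Lorentzian.TameGenericityDiagonal
import Literature.Geometry.Lorentzian.DataFamilyTangentKernel
import Literature.Geometry.Lorentzian.TameGenericityLocalWindowImmersed
import HarnessLib

/-!
# Injectivity and immersion of tame witness curves are GAUGE-BORNE: the gauged family of a tame curve,
# and tame Christodoulou genericity from merely TAME curves

The tame genericity notion of the final state conjecture (`InitialDataSet.IsTameDataFamily`,
`IsImmersedAtZero`, `TameGenericity.lean`) asks witness curves to be tame on one end, INJECTIVE and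
IMMERSED at the base parameter. Constructions along a given tame curve `H : ℝ¹ → data` (sections of
unfoldings, diagonal families, reparametrised rays) deliver tameness but neither injectivity nor
immersion — e.g. a ray run by an even reparametrisation is flat at the corner. This file proves that
BOTH ARE GAUGE-BORNE. For breathing data `B : e.BreathingData z₀ r` far out on the end
(`AFEndBreathing*.lean`) the GAUGED FAMILY

  `c ↦ E_{c₀}(H (ρ c)) = AFEnd.breatheFamily B (H (ρ c)) c₀`,  `ρ c := (c₀)² e₀`,  `c₀ = c 0`

— the breathing deformation (pull-back along a compactly supported diffeomorphism of `X`) of the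
QUADRATICALLY REPARAMETRISED curve, written out (no definition) — is tame, immersed at `0`, made of
admissible data when `H` is, and carries every breathing-invariant property of the members of `H`; so
injectivity comes for free on a window (`exists_tameCurve_of_localWindow`). Contents (all proved; no
definitions, no named facts):

* §1 the reparametrisation `ρ` (`InitialDataSet.contDiff_quadAxis`, `quadAxis_zero`, `quadAxis_ne_zero`)
  and two calculus lemmas (`contDiffAt_uncurry_sub`; the `Φ 0 = 0` form
  `tendsto_iSup_weight_iteratedFDeriv_nhds_zero_of_base_zero` of
  `tendsto_iSup_weight_iteratedFDeriv_sub_nhds_zero`);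
* §2 tame families restrict to collared ends (`AFEnd.wDist_restrict_le`,
  `InitialDataSet.IsTameDataFamily.restrict`);
* §3 the gauged family (`AFEnd.breatheQuad_*`, `AFEnd.*_breatheQuad`): through `H 0`; jointly smooth
  (`contMDiff_breatheFamily_family_h/k` read through `pr = ρ`, `τ = proj₀`); agreeing with `H (ρ c)` on
  `far (‖z₀‖ + r)`, hence DR-flat with the same masses; `wDist (E_{c₀}(H (ρ c))) (H (ρ c)) → 0` on
  every collared end (the chart-component differences are jointly smooth, vanish at `c = 0` and beyond
  `‖z₀‖ + r`, so they are `O(‖c‖)` in weighted `C² × C¹` on a compact annulus); TAME on every collared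
  end (`IsTameDataFamily.of_wDist_tendsto` riding `H ∘ ρ`); IMMERSED at `0` — the centre marker
  `c ↦ (1 + σ c₀)² · h_{H (ρ c)}(x₀)(v₀, v₀)` (`breatheFamily_h_inner_center`) has derivative
  `2 σ'(0) h_{H 0}(x₀)(v₀, v₀) ≠ 0` at `0`, the `H`-factor being `φ ((c₀)²)` with `φ` smooth
  (`contDiff_h_inner_line`), so that its first variation vanishes (this is what the quadratic
  reparametrisation is for); admissible members; breathing-invariant properties pass to the members
  off `0` (`ρ c ≠ 0` there);
* §4 `InitialDataSet.exists_tameCurve_upgrade_of_breatheInvariant` — **the gauge-borne upgrade**: for a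
  property `P` invariant under the breathing deformations of the end `e`, every TAME curve of admissible
  data on `e` whose members off `0` satisfy `P` is replaced by a tame (on a collared end), INJECTIVE,
  IMMERSED curve of admissible data through the same base datum whose members off `0` satisfy `P`;
  `InitialDataSet.hasTameCodimAtLeastIn_one_of_tameCurves`,
  `InitialDataSet.isTameChristodoulouGeneric_one_of_tameCurves` — **tame Christodoulou genericity of
  codimension one from merely tame curves** for breathing-invariant `P`.

Breathing invariance, `∀ (e) {z₀ r} (B : e.BreathingData z₀ r) (d) (t : ℝ), P d → P (E_t d)`, holds for
every property transported along diffeomorphisms of `X` that are the identity far out (Kerr-endedness,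
censoredness, the settling clause of the final state conjecture — each by the `comap` lemmas of its own
file); consumers discharge it there. First consumer, in specialised form (landed earlier under
`Summits/FinalStateConjecture/FinalStateConjecture/Theorems/ExactKerrEndsSettlingAlongCensoredKerrEnds{GaugedFamilyPrep,GaugedFamily,GaugeBorneUpgrade}.lean`,
whose §1–§3 this file restates model-free so that Literature and every other route can import them):
stub GU of crux `SettlingAlongCensoredKerrEnds`, route ExactKerrEnds of the final state summit.

## References

* D. Christodoulou, *On the global initial value problem and the issue of singularities*, CQG 16 (1999)
  A23–A35, p. A24 (genericity by lines `α₀ + c f` in a fixed space of data); Ann. Math. 149 (1999) 183,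
  p. 187. [Christodoulou1999]
* J. M. Lee, *Introduction to Smooth Manifolds*, 2nd ed. (2013), Prop. 2.25. [LeeSmoothManifolds2013]
* R. Bartnik, J. Isenberg, *The constraint equations* (2004), §2. [BartnikIsenberg2004]
* M. Dafermos, I. Rodnianski, *Lectures on black holes and linear waves*, arXiv:0811.0354, App. B.2.3.
  [DafermosRodnianski2013]
* J. Dieudonné, *Foundations of Modern Analysis* (1960), (8.5.4), (8.12.6).
-/

noncomputable section

open Set Function Filter Metric TopologicalSpace Bundle
open scoped Manifold ContDiff Topology ENNReal

namespace Literature.Geometry.Lorentzian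

/-! ### §1 The quadratic reparametrisation `ρ c = (c 0)² e₀` of `ℝ¹` -/

/-- `ρ c = (c 0)² e₀` is smooth. [folklore] -/
theorem InitialDataSet.contDiff_quadAxis :
    ContDiff ℝ ∞ (fun c : EuclideanSpace ℝ (Fin 1) ↦
      (EuclideanSpace.single 0 ((c 0) ^ 2) : EuclideanSpace ℝ (Fin 1))) :=
  InitialDataSet.contDiff_single_zero.comp
    ((contDiff_piLp_apply (𝕜 := ℝ) (n := ∞) (p := 2) (E := fun _ : Fin 1 => ℝ) (i := 0)).pow 2)

/-- `ρ 0 = 0`. [folklore] -/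
theorem InitialDataSet.quadAxis_zero :
    (EuclideanSpace.single 0 (((0 : EuclideanSpace ℝ (Fin 1)) 0) ^ 2) : EuclideanSpace ℝ (Fin 1)) = 0 := by
  simp

/-- `ρ c ≠ 0` for `c ≠ 0`. [folklore] -/
theorem InitialDataSet.quadAxis_ne_zero {c : EuclideanSpace ℝ (Fin 1)} (hc : c ≠ 0) :
    (EuclideanSpace.single 0 ((c 0) ^ 2) : EuclideanSpace ℝ (Fin 1)) ≠ 0 := by
  have hc0 : c 0 ≠ 0 := by
    intro h
    apply hc
    ext i
    rw [Subsingleton.elim i 0, h]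
    rfl
  intro h
  have := congrArg (fun v : EuclideanSpace ℝ (Fin 1) ↦ v 0) h
  simp only [PiLp.single_apply, if_true, PiLp.zero_apply] at this
  exact pow_ne_zero 2 hc0 this

/-- **Differences of jointly smooth two-argument families are jointly smooth** (`ContDiffAt.sub`
read through `Function.uncurry`; stated with the families as variables so that the identification
`uncurry (A − B) = uncurry A − uncurry B` is checked on opaque symbols). [folklore] -/
theorem contDiffAt_uncurry_sub {P : Type*} [NormedAddCommGroup P] [NormedSpace ℝ P]
    {F : Type*} [NormedAddCommGroup F] [NormedSpace ℝ F] {A A' : P → E3 → F} {q : P × E3}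
    (hA : ContDiffAt ℝ ∞ (uncurry A) q) (hA' : ContDiffAt ℝ ∞ (uncurry A') q) :
    ContDiffAt ℝ ∞ (uncurry fun (c : P) (z : E3) ↦ A c z - A' c z) q := by
  have h : (uncurry fun (c : P) (z : E3) ↦ A c z - A' c z) = fun x ↦ uncurry A x - uncurry A' x := by
    funext x
    rfl
  rw [h]
  exact hA.sub hA'

/-- **Weighted `Cⁿ`-suprema of a smooth family vanishing at the base parameter tend to zero**: the
form of `tendsto_iSup_weight_iteratedFDeriv_sub_nhds_zero` for a family `Φ` with `Φ 0 = 0` (then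
`Φ c − Φ 0 = Φ c`; the rewriting is done here, on a generic normed space, once and for all).
Dieudonné 1960, (8.5.4), (8.12.6). [folklore] -/
theorem tendsto_iSup_weight_iteratedFDeriv_nhds_zero_of_base_zero
    {P : Type*} [NormedAddCommGroup P] [NormedSpace ℝ P] [ProperSpace P]
    {F : Type*} [NormedAddCommGroup F] [NormedSpace ℝ F]
    {Φ : P → E3 → F} {R R₁ R₂ : ℝ} (hR : R < R₁)
    (hΦ : ∀ (c : P) (z : E3), R < ‖z‖ → ContDiffAt ℝ ∞ (uncurry Φ) (c, z))
    (hfar : ∀ (c : P) (z : E3), R₂ < ‖z‖ → Φ c z = Φ 0 z) (h0 : ∀ z : E3, Φ 0 z = 0) (n w : ℕ) :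
    Tendsto (fun c : P ↦ ⨆ (i : ℕ) (_ : i ≤ n) (x : E3) (_ : R₁ < ‖x‖),
      ENNReal.ofReal (‖x‖ ^ (w + i)) * ‖iteratedFDeriv ℝ i (Φ c) x‖ₑ) (𝓝 0) (𝓝 0) := by
  have h := tendsto_iSup_weight_iteratedFDeriv_sub_nhds_zero hR hΦ hfar n w
  have heq : ∀ c : P, (fun y ↦ Φ c y - Φ 0 y) = Φ c := fun c ↦ funext fun y ↦ by
    rw [h0 y, sub_zero]
  simp only [heq] at h
  exact h

/-! ### §2 Tame families restrict to collared ends -/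

variable {X : Type} [TopologicalSpace X] [ChartedSpace E3 X] [IsManifold (𝓡 3) ∞ X]

/-- **The weighted distance on a collared end is dominated by the one on the end**:
`(e.restrict _).wDist D D' ≤ e.wDist D D'` (same integrands, smaller region `{R₁ < ‖x‖}`).
[cite: DafermosRodnianski2013, App. B.2.3] -/
theorem AFEnd.wDist_restrict_le (e : AFEnd X) {R₁ : ℝ} (hR₁ : e.R < R₁) (D D' : InitialDataSet (𝓡 3) X) :
    (e.restrict hR₁.le).wDist D D' ≤ e.wDist D D' := by
  rw [e.wDist_restrict_eq hR₁.le D D']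
  unfold AFEnd.wDist
  refine add_le_add ?_ ?_
  · refine iSup₂_le fun m hm ↦ iSup₂_le fun x hx ↦ ?_
    exact le_iSup₂_of_le m hm (le_iSup₂_of_le (f := fun (x : E3) (_ : e.R < ‖x‖) ↦
      ENNReal.ofReal (‖x‖ ^ (1 + m)) *
        ‖iteratedFDeriv ℝ m (fun y ↦ AFEnd.hCoeff e D y - AFEnd.hCoeff e D' y) x‖ₑ)
      x (hR₁.trans hx) le_rfl)
  · refine iSup₂_le fun m hm ↦ iSup₂_le fun x hx ↦ ?_
    exact le_iSup₂_of_le m hm (le_iSup₂_of_le (f := fun (x : E3) (_ : e.R < ‖x‖) ↦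
      ENNReal.ofReal (‖x‖ ^ (2 + m)) *
        ‖iteratedFDeriv ℝ m (fun y ↦ AFEnd.kCoeff e D y - AFEnd.kCoeff e D' y) x‖ₑ)
      x (hR₁.trans hx) le_rfl)

/-- **Tame families restrict to collared ends**: `F` tame on `e` is tame on `e.restrict _` for every
`R₁ > e.R` (soleness and DR decay are unchanged by the collar, `isSoleEnd_restrict_iff`,
`isStronglyAsymptoticallyFlatDR_restrict_iff`; the weighted distance only decreases,
`wDist_restrict_le`). [cite: Christodoulou1999, p. A24] -/
theorem InitialDataSet.IsTameDataFamily.restrict {e : AFEnd X} {m : ℕ}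
    {F : EuclideanSpace ℝ (Fin m) → InitialDataSet (𝓡 3) X}
    (hF : InitialDataSet.IsTameDataFamily e m F) {R₁ : ℝ} (hR₁ : e.R < R₁) :
    InitialDataSet.IsTameDataFamily (e.restrict hR₁.le) m F := by
  obtain ⟨hs, hsole, ⟨M, hM, hSAF⟩, hlim⟩ := hF
  refine ⟨hs, (e.isSoleEnd_restrict_iff hR₁.le).2 hsole,
    ⟨M, hM, fun c ↦ (e.isStronglyAsymptoticallyFlatDR_restrict_iff hR₁.le _ _).2 (hSAF c)⟩, ?_⟩
  exact tendsto_of_tendsto_of_tendsto_of_le_of_le tendsto_const_nhds hlim (fun _ ↦ zero_le)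
    fun c ↦ e.wDist_restrict_le hR₁ (F c) (F 0)

namespace AFEnd

/-! ### §3 The gauged family `F' c = (breathe (σ (c 0)))^* (H ((c 0)² e₀))` -/

section Gauged

variable [T2Space X] {e : AFEnd X} {z₀ : E3} {r : ℝ} (B : AFEnd.BreathingData e z₀ r)
  (H : EuclideanSpace ℝ (Fin 1) → InitialDataSet (𝓡 3) X)

/-- **The gauged family passes through `H 0`** (`ρ 0 = 0`, `σ 0 = 0`, `breathe 0 = id`). [folklore] -/
theorem breatheQuad_zero :
    AFEnd.breatheFamily B (H (EuclideanSpace.single 0 (((0 : EuclideanSpace ℝ (Fin 1)) 0) ^ 2)))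
        ((0 : EuclideanSpace ℝ (Fin 1)) 0) = H 0 := by
  rw [InitialDataSet.quadAxis_zero]
  exact AFEnd.breatheFamily_zero B (H 0)

/-- **The gauged family is jointly smooth** (breathing of the smooth family `H` read through the smooth
parameter maps `pr = ρ`, `τ = proj₀`: `AFEnd.contMDiff_breatheFamily_family_h/k`).
[cite: LeeSmoothManifolds2013, Prop. 2.25] -/
theorem isSmoothDataFamily_breatheQuad (hH : InitialDataSet.IsSmoothDataFamily 1 H) :
    InitialDataSet.IsSmoothDataFamily 1 (fun c : EuclideanSpace ℝ (Fin 1) ↦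
      AFEnd.breatheFamily B (H (EuclideanSpace.single 0 ((c 0) ^ 2))) (c 0)) := by
  have hτ : ContDiff ℝ ∞ (fun c : EuclideanSpace ℝ (Fin 1) ↦ c 0) :=
    contDiff_piLp_apply (𝕜 := ℝ) (n := ∞) (p := 2) (E := fun _ : Fin 1 => ℝ) (i := 0)
  exact ⟨AFEnd.contMDiff_breatheFamily_family_h B
      (pr := fun c : EuclideanSpace ℝ (Fin 1) ↦
        (EuclideanSpace.single 0 ((c 0) ^ 2) : EuclideanSpace ℝ (Fin 1)))
      (τ := fun c : EuclideanSpace ℝ (Fin 1) ↦ c 0) (G := H) InitialDataSet.contDiff_quadAxis hτ hH.1,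
    AFEnd.contMDiff_breatheFamily_family_k B
      (pr := fun c : EuclideanSpace ℝ (Fin 1) ↦
        (EuclideanSpace.single 0 ((c 0) ^ 2) : EuclideanSpace ℝ (Fin 1)))
      (τ := fun c : EuclideanSpace ℝ (Fin 1) ↦ c 0) (G := H) InitialDataSet.contDiff_quadAxis hτ hH.2⟩

/-- **The base member of the gauged family IS `H (ρ 0)`** (the form in which the two families are
compared: `σ 0 = 0`, `breathe 0 = id`). [folklore] -/
theorem breatheQuad_zero' :
    AFEnd.breatheFamily B (H (EuclideanSpace.single 0 (((0 : EuclideanSpace ℝ (Fin 1)) 0) ^ 2)))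
        ((0 : EuclideanSpace ℝ (Fin 1)) 0) =
      H (EuclideanSpace.single 0 (((0 : EuclideanSpace ℝ (Fin 1)) 0) ^ 2)) := by
  have h00 : ((0 : EuclideanSpace ℝ (Fin 1)) 0 : ℝ) = 0 := rfl
  simp only [h00]
  exact AFEnd.breatheFamily_zero B _

/-- **The gauged members agree with `H (ρ c)` on the far region `far (‖z₀‖ + r)`** (the breathing
diffeomorphism is the identity off the core). [cite: Bartnik1986, §1] -/
theorem breatheQuad_agree_far (c : EuclideanSpace ℝ (Fin 1)) {q : X} (hq : q ∈ e.far (‖z₀‖ + r)) :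
    (AFEnd.breatheFamily B (H (EuclideanSpace.single 0 ((c 0) ^ 2))) (c 0)).h.inner q =
        (H (EuclideanSpace.single 0 ((c 0) ^ 2))).h.inner q ∧
      (AFEnd.breatheFamily B (H (EuclideanSpace.single 0 ((c 0) ^ 2))) (c 0)).k q =
        (H (EuclideanSpace.single 0 ((c 0) ^ 2))).k q :=
  AFEnd.breatheFamily_eq_of_mem_far B _ (c 0) le_rfl hq

include B in
omit [IsManifold (𝓡 3) ∞ X] [T2Space X] in
/-- `max (‖z₀‖ + r) e.R = ‖z₀‖ + r` (the breathing ball lies in the exterior region). [folklore] -/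
theorem max_far_radius_lt {z : E3} (hz : ‖z₀‖ + r < ‖z‖) : max (‖z₀‖ + r) e.R < ‖z‖ := by
  have hR₀ : e.R < ‖z₀‖ + r := by linarith [B.R_lt_norm_center, B.r_pos]
  rw [max_eq_left hR₀.le]
  exact hz

/-- **The chart components of `h` of the gauged members agree with those of `H (ρ c)` beyond
`‖z₀‖ + r`.** [cite: Bartnik1986, (1.3)] -/
theorem hCoeff_breatheQuad_eq (c : EuclideanSpace ℝ (Fin 1)) {z : E3} (hz : ‖z₀‖ + r < ‖z‖) :
    AFEnd.hCoeff e (AFEnd.breatheFamily B (H (EuclideanSpace.single 0 ((c 0) ^ 2))) (c 0)) z =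
      AFEnd.hCoeff e (H (EuclideanSpace.single 0 ((c 0) ^ 2))) z :=
  e.hCoeff_eq_of_agree_far (fun _ hq ↦ (breatheQuad_agree_far B H c hq).1) (max_far_radius_lt B hz)

/-- **The chart components of `k` of the gauged members agree with those of `H (ρ c)` beyond
`‖z₀‖ + r`.** [cite: ChristodoulouKlainerman1993, (1.0.9)] -/
theorem kCoeff_breatheQuad_eq (c : EuclideanSpace ℝ (Fin 1)) {z : E3} (hz : ‖z₀‖ + r < ‖z‖) :
    AFEnd.kCoeff e (AFEnd.breatheFamily B (H (EuclideanSpace.single 0 ((c 0) ^ 2))) (c 0)) z =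
      AFEnd.kCoeff e (H (EuclideanSpace.single 0 ((c 0) ^ 2))) z :=
  e.kCoeff_eq_of_agree_far (fun _ hq ↦ (breatheQuad_agree_far B H c hq).2) (max_far_radius_lt B hz)

/-- **The gauged members are DR-flat with the masses of `H (ρ c)`** (they agree on a far region,
`IsStronglyAsymptoticallyFlatDR.congr_of_eqOn_far`). [cite: DafermosRodnianski2013, App. B.2.3] -/
theorem isStronglyAsymptoticallyFlatDR_breatheQuad {c : EuclideanSpace ℝ (Fin 1)} {M : ℝ}
    (h : e.IsStronglyAsymptoticallyFlatDR (H (EuclideanSpace.single 0 ((c 0) ^ 2))) M) :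
    e.IsStronglyAsymptoticallyFlatDR
      (AFEnd.breatheFamily B (H (EuclideanSpace.single 0 ((c 0) ^ 2))) (c 0)) M :=
  h.congr_of_eqOn_far (fun _ hq ↦ (breatheQuad_agree_far B H c hq).1)
    (fun _ hq ↦ (breatheQuad_agree_far B H c hq).2)

-- the operator norm on `E3 →L[ℝ] E3 →L[ℝ] ℝ` is slow to synthesize through `PiLp` (as in
-- `AFEndBreathingFamily.lean`); `sub_self` on that space needs it
set_option synthInstance.maxHeartbeats 100000 in
/-- **The weighted distance of the gauged member to `H (ρ c)` on a collared end tends to `0` with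
`c`.** The differences of the chart components are jointly smooth in `(c, z)` on the exterior region
(`AFEnd.contDiffAt_hCoeff_family` / `contDiffAt_kCoeff_family` for the two smooth families), vanish
beyond `‖z₀‖ + r` and identically at `c = 0` (the base member IS `H (ρ 0)`), so their weighted
`C² × C¹` suprema over `{R₁ < ‖x‖}` are `O(‖c‖)` on a compact annulus
(`tendsto_iSup_weight_iteratedFDeriv_sub_nhds_zero`); read on the collar by `AFEnd.wDist_restrict_eq`.
[cite: DafermosRodnianski2013, App. B.2.3] -/
theorem tendsto_wDist_breatheQuad (hH : InitialDataSet.IsSmoothDataFamily 1 H) {R₁ : ℝ} (hR₁ : e.R < R₁) :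
    Tendsto (fun c : EuclideanSpace ℝ (Fin 1) ↦ (e.restrict hR₁.le).wDist
      (AFEnd.breatheFamily B (H (EuclideanSpace.single 0 ((c 0) ^ 2))) (c 0))
      (H (EuclideanSpace.single 0 ((c 0) ^ 2)))) (𝓝 0) (𝓝 0) := by
  -- `t - t = 0` on the space of bilinear forms, synthesized once
  have hss : ∀ t : E3 →L[ℝ] E3 →L[ℝ] ℝ, t - t = 0 := fun t ↦ sub_self t
  have hs := isSmoothDataFamily_breatheQuad B H hH
  have hsρ : InitialDataSet.IsSmoothDataFamily 1 (fun c : EuclideanSpace ℝ (Fin 1) ↦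
      H (EuclideanSpace.single 0 ((c 0) ^ 2))) := hH.comp_contDiff InitialDataSet.contDiff_quadAxis
  -- the two difference families: jointly smooth on the exterior region
  have hΦs : ∀ (c : EuclideanSpace ℝ (Fin 1)) (z : E3), e.R < ‖z‖ →
      ContDiffAt ℝ ∞ (uncurry fun (c : EuclideanSpace ℝ (Fin 1)) (z : E3) ↦
        AFEnd.hCoeff e (AFEnd.breatheFamily B (H (EuclideanSpace.single 0 ((c 0) ^ 2))) (c 0)) z -
          AFEnd.hCoeff e (H (EuclideanSpace.single 0 ((c 0) ^ 2))) z) (c, z) := fun c z hz ↦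
    contDiffAt_uncurry_sub (AFEnd.contDiffAt_hCoeff_family hs.1 c hz)
      (AFEnd.contDiffAt_hCoeff_family hsρ.1 c hz)
  have hΨs : ∀ (c : EuclideanSpace ℝ (Fin 1)) (z : E3), e.R < ‖z‖ →
      ContDiffAt ℝ ∞ (uncurry fun (c : EuclideanSpace ℝ (Fin 1)) (z : E3) ↦
        AFEnd.kCoeff e (AFEnd.breatheFamily B (H (EuclideanSpace.single 0 ((c 0) ^ 2))) (c 0)) z -
          AFEnd.kCoeff e (H (EuclideanSpace.single 0 ((c 0) ^ 2))) z) (c, z) := fun c z hz ↦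
    contDiffAt_uncurry_sub (AFEnd.contDiffAt_kCoeff_family hs.2 c hz)
      (AFEnd.contDiffAt_kCoeff_family hsρ.2 c hz)
  -- … and vanishing beyond `‖z₀‖ + r`
  have hΦfar : ∀ (c : EuclideanSpace ℝ (Fin 1)) (z : E3), ‖z₀‖ + r < ‖z‖ →
      AFEnd.hCoeff e (AFEnd.breatheFamily B (H (EuclideanSpace.single 0 ((c 0) ^ 2))) (c 0)) z -
          AFEnd.hCoeff e (H (EuclideanSpace.single 0 ((c 0) ^ 2))) z =
        AFEnd.hCoeff e (AFEnd.breatheFamily B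
            (H (EuclideanSpace.single 0 (((0 : EuclideanSpace ℝ (Fin 1)) 0) ^ 2)))
            ((0 : EuclideanSpace ℝ (Fin 1)) 0)) z -
          AFEnd.hCoeff e (H (EuclideanSpace.single 0 (((0 : EuclideanSpace ℝ (Fin 1)) 0) ^ 2))) z := by
    intro c z hz
    rw [hCoeff_breatheQuad_eq B H c hz, hCoeff_breatheQuad_eq B H 0 hz, hss, hss]
  have hΨfar : ∀ (c : EuclideanSpace ℝ (Fin 1)) (z : E3), ‖z₀‖ + r < ‖z‖ →
      AFEnd.kCoeff e (AFEnd.breatheFamily B (H (EuclideanSpace.single 0 ((c 0) ^ 2))) (c 0)) z -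
          AFEnd.kCoeff e (H (EuclideanSpace.single 0 ((c 0) ^ 2))) z =
        AFEnd.kCoeff e (AFEnd.breatheFamily B
            (H (EuclideanSpace.single 0 (((0 : EuclideanSpace ℝ (Fin 1)) 0) ^ 2)))
            ((0 : EuclideanSpace ℝ (Fin 1)) 0)) z -
          AFEnd.kCoeff e (H (EuclideanSpace.single 0 (((0 : EuclideanSpace ℝ (Fin 1)) 0) ^ 2))) z := by
    intro c z hz
    rw [kCoeff_breatheQuad_eq B H c hz, kCoeff_breatheQuad_eq B H 0 hz, hss, hss]
  -- at `c = 0` the differences vanish identically (the base member IS `H (ρ 0)`)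
  have hbase := breatheQuad_zero' B H
  have hΦ0 : ∀ z : E3,
      AFEnd.hCoeff e (AFEnd.breatheFamily B
          (H (EuclideanSpace.single 0 (((0 : EuclideanSpace ℝ (Fin 1)) 0) ^ 2)))
          ((0 : EuclideanSpace ℝ (Fin 1)) 0)) z -
        AFEnd.hCoeff e (H (EuclideanSpace.single 0 (((0 : EuclideanSpace ℝ (Fin 1)) 0) ^ 2))) z = 0 := by
    intro z
    rw [hbase]
    exact hss _
  have hΨ0 : ∀ z : E3,
      AFEnd.kCoeff e (AFEnd.breatheFamily B
          (H (EuclideanSpace.single 0 (((0 : EuclideanSpace ℝ (Fin 1)) 0) ^ 2)))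
          ((0 : EuclideanSpace ℝ (Fin 1)) 0)) z -
        AFEnd.kCoeff e (H (EuclideanSpace.single 0 (((0 : EuclideanSpace ℝ (Fin 1)) 0) ^ 2))) z = 0 := by
    intro z
    rw [hbase]
    exact hss _
  have hA := tendsto_iSup_weight_iteratedFDeriv_nhds_zero_of_base_zero
    (Φ := fun (c : EuclideanSpace ℝ (Fin 1)) (z : E3) ↦
      AFEnd.hCoeff e (AFEnd.breatheFamily B (H (EuclideanSpace.single 0 ((c 0) ^ 2))) (c 0)) z -
        AFEnd.hCoeff e (H (EuclideanSpace.single 0 ((c 0) ^ 2))) z) hR₁ hΦs hΦfar hΦ0 2 1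
  have hB' := tendsto_iSup_weight_iteratedFDeriv_nhds_zero_of_base_zero
    (Φ := fun (c : EuclideanSpace ℝ (Fin 1)) (z : E3) ↦
      AFEnd.kCoeff e (AFEnd.breatheFamily B (H (EuclideanSpace.single 0 ((c 0) ^ 2))) (c 0)) z -
        AFEnd.kCoeff e (H (EuclideanSpace.single 0 ((c 0) ^ 2))) z) hR₁ hΨs hΨfar hΨ0 1 2
  have hsum := hA.add hB'
  rw [add_zero] at hsum
  -- these are the integrands of the weighted distance on the collar
  refine hsum.congr' (Eventually.of_forall fun c ↦ ?_)
  exact (e.wDist_restrict_eq hR₁.le _ _).symm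

/-- **The gauged family is TAME on every collared end.** Ride the tame curve `c ↦ H (ρ c)`
(`IsTameDataFamily.comp_contDiff`, restricted to the collar, `isTameDataFamily_restrict`): the gauged
family is jointly smooth, passes through the same base member, its members are DR-flat with the same
(continuous) masses (`isStronglyAsymptoticallyFlatDR_breatheQuad`), and `wDist (F' c) (H (ρ c)) → 0`
(`tendsto_wDist_breatheQuad`); conclude by `IsTameDataFamily.of_wDist_tendsto`.
[cite: Christodoulou1999, p. A24] -/
theorem isTameDataFamily_restrict_breatheQuad (hH : InitialDataSet.IsTameDataFamily e 1 H) {R₁ : ℝ}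
    (hR₁ : e.R < R₁) :
    InitialDataSet.IsTameDataFamily (e.restrict hR₁.le) 1 (fun c : EuclideanSpace ℝ (Fin 1) ↦
      AFEnd.breatheFamily B (H (EuclideanSpace.single 0 ((c 0) ^ 2))) (c 0)) := by
  -- the reparametrised base curve and its tameness on the collar
  have hHρ : InitialDataSet.IsTameDataFamily e 1 (fun c : EuclideanSpace ℝ (Fin 1) ↦
      H (EuclideanSpace.single 0 ((c 0) ^ 2))) := hH.comp_contDiff InitialDataSet.contDiff_quadAxis InitialDataSet.quadAxis_zero
  have hHρ' := hHρ.restrict hR₁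
  obtain ⟨-, -, ⟨M, hM, hSAF⟩, -⟩ := hHρ
  -- base member
  have h0 : (fun c : EuclideanSpace ℝ (Fin 1) ↦
      AFEnd.breatheFamily B (H (EuclideanSpace.single 0 ((c 0) ^ 2))) (c 0)) 0 =
        (fun c : EuclideanSpace ℝ (Fin 1) ↦ H (EuclideanSpace.single 0 ((c 0) ^ 2))) 0 :=
    breatheQuad_zero' B H
  -- decay of the members on the collar, masses `M (ρ c)`
  have hDR : ∀ c : EuclideanSpace ℝ (Fin 1), (e.restrict hR₁.le).IsStronglyAsymptoticallyFlatDR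
      (AFEnd.breatheFamily B (H (EuclideanSpace.single 0 ((c 0) ^ 2))) (c 0)) (M c) := fun c ↦
    (e.isStronglyAsymptoticallyFlatDR_restrict_iff hR₁.le _ _).2
      (isStronglyAsymptoticallyFlatDR_breatheQuad B H (hSAF c))
  exact hHρ'.of_wDist_tendsto (isSmoothDataFamily_breatheQuad B H hH.1) h0 hM hDR
    (tendsto_wDist_breatheQuad B H hH.1 hR₁)

end Gauged

end AFEnd


namespace AFEnd

section Gauged

variable {X : Type} [TopologicalSpace X] [ChartedSpace E3 X] [IsManifold (𝓡 3) ∞ X] [T2Space X]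
  {e : AFEnd X} {z₀ : E3} {r : ℝ} (B : AFEnd.BreathingData e z₀ r)
  (H : EuclideanSpace ℝ (Fin 1) → InitialDataSet (𝓡 3) X)

/-- **The gauged family is IMMERSED at the base parameter.** At the centre `x₀ = Φₑ z₀` and for
`v₀ = e₀`, the marker `c ↦ h_{F' c}(x₀)(v₀, v₀) = (1 + σ c₀)² · h_{H (ρ c)}(x₀)(v₀, v₀)`
(`breatheFamily_h_inner_center`) is `g c₀` with `g t = (1 + σ t)² · φ (t²)`, `φ` smooth
(`contDiff_h_inner_line`); so `g' 0 = 2 σ'(0) φ 0 > 0` (`σ'(0) = s₀/π > 0`, `φ 0 = h_{H 0}(x₀)(v₀, v₀) > 0`: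
the first variation of the `H`-factor is killed by the quadratic reparametrisation), and the
`v`-derivative at `0` is `g' 0 · v₀ ≠ 0` for `v ≠ 0`. [cite: Christodoulou1999, p. A24] -/
theorem isImmersedAtZero_breatheQuad (hH : InitialDataSet.IsSmoothDataFamily 1 H) :
    InitialDataSet.IsImmersedAtZero 1 (fun c : EuclideanSpace ℝ (Fin 1) ↦
      AFEnd.breatheFamily B (H (EuclideanSpace.single 0 ((c 0) ^ 2))) (c 0)) := by
  intro v hv
  -- the direction has a non-zero coordinate
  have hv0 : v 0 ≠ 0 := by
    intro h
    apply hv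
    ext i
    fin_cases i
    simpa using h
  -- the centre, a non-zero tangent vector, and the smooth positive factor `φ`
  set x₀ : X := e.dataChartExt z₀ with hx₀
  set v₀ : TangentSpace (𝓡 3) x₀ := (EuclideanSpace.single (0 : Fin 3) (1 : ℝ) : E3) with hv₀
  have hv₀ne : v₀ ≠ 0 := by
    have h : (EuclideanSpace.single (0 : Fin 3) (1 : ℝ) : E3) ≠ 0 := by
      rw [← norm_ne_zero_iff, PiLp.norm_single, norm_one]
      exact one_ne_zero
    exact h
  set φ : ℝ → ℝ := fun s ↦ (H (EuclideanSpace.single 0 s)).h.inner x₀ v₀ v₀ with hφ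
  have hφs : ContDiff ℝ ∞ φ := InitialDataSet.contDiff_h_inner_line hH x₀ v₀ v₀
  have hφ0 : 0 < φ 0 := (H (EuclideanSpace.single 0 0)).h.pos x₀ v₀ hv₀ne
  refine ⟨x₀, v₀, v₀, Or.inl ?_⟩
  -- the marker along the family is `g (c 0)` with `g t = (1 + σ t)² · φ (t²)`
  have hline : (fun c : EuclideanSpace ℝ (Fin 1) ↦
      (AFEnd.breatheFamily B (H (EuclideanSpace.single 0 ((c 0) ^ 2))) (c 0)).h.inner x₀ v₀ v₀) =
        (fun t : ℝ ↦ (1 + AFEnd.squash B t) ^ 2 * φ (t ^ 2)) ∘ fun c ↦ c 0 := by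
    funext c
    simp only [hφ, Function.comp_apply]
    exact AFEnd.breatheFamily_h_inner_center B _ (c 0) v₀ v₀
  -- derivative of `g` at `0`
  have hsq : HasDerivAt (AFEnd.squash B) (AFEnd.breatheScale B / Real.pi) 0 := by
    have h := (Real.hasDerivAt_arctan 0).const_mul (AFEnd.breatheScale B / Real.pi)
    simp only [ne_eq, OfNat.ofNat_ne_zero, not_false_eq_true, zero_pow, add_zero, div_one,
      mul_one] at h
    exact h
  have hg1 : HasDerivAt (fun t : ℝ ↦ (1 + AFEnd.squash B t) ^ 2)
      ((2 : ℕ) * (1 + AFEnd.squash B 0) ^ (2 - 1) * (AFEnd.breatheScale B / Real.pi)) 0 :=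
    (hsq.const_add 1).pow 2
  have hφd : HasDerivAt φ (deriv φ ((0 : ℝ) ^ 2)) ((0 : ℝ) ^ 2) :=
    ((hφs.differentiable (by simp)) _).hasDerivAt
  have hpow : HasDerivAt (fun t : ℝ ↦ t ^ 2) ((2 : ℕ) * (0 : ℝ) ^ (2 - 1)) 0 := hasDerivAt_pow 2 0
  have hg2 : HasDerivAt (fun t : ℝ ↦ φ (t ^ 2)) (deriv φ ((0 : ℝ) ^ 2) * ((2 : ℕ) * (0 : ℝ) ^ (2 - 1))) 0 :=
    HasDerivAt.comp_of_eq (x := (0 : ℝ)) (hh₂ := hφd) (hh := hpow) (hy := rfl)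
  have hgd : HasDerivAt (fun t : ℝ ↦ (1 + AFEnd.squash B t) ^ 2 * φ (t ^ 2))
      ((2 : ℕ) * (1 + AFEnd.squash B 0) ^ (2 - 1) * (AFEnd.breatheScale B / Real.pi) * φ (0 ^ 2) +
        (1 + AFEnd.squash B 0) ^ 2 * (deriv φ ((0 : ℝ) ^ 2) * ((2 : ℕ) * (0 : ℝ) ^ (2 - 1))))
      ((fun c : EuclideanSpace ℝ (Fin 1) ↦ c 0) 0) := by
    have : ((fun c : EuclideanSpace ℝ (Fin 1) ↦ c 0) 0) = 0 := rfl
    rw [this]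
    exact hg1.fun_mul hg2
  have hproj : HasFDerivAt (𝕜 := ℝ) (fun c : EuclideanSpace ℝ (Fin 1) ↦ c 0)
      (PiLp.proj (𝕜 := ℝ) 2 (fun _ : Fin 1 ↦ ℝ) 0) 0 :=
    PiLp.hasFDerivAt_apply 2 (0 : EuclideanSpace ℝ (Fin 1)) 0
  have hcomp := hgd.comp_hasFDerivAt (0 : EuclideanSpace ℝ (Fin 1)) hproj
  rw [hline, hcomp.fderiv]
  simp only [FunLike.coe_smul, Pi.smul_apply, PiLp.proj_apply, AFEnd.squash_zero,
    smul_eq_mul]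
  have hs₀ := (AFEnd.breatheScale_spec B).1
  refine mul_ne_zero ?_ hv0
  have hval : ((2 : ℕ) : ℝ) * (1 + 0) ^ (2 - 1) * (AFEnd.breatheScale B / Real.pi) * φ (0 ^ 2) +
      (1 + 0) ^ 2 * (deriv φ ((0 : ℝ) ^ 2) * ((2 : ℕ) * (0 : ℝ) ^ (2 - 1))) =
        2 * (AFEnd.breatheScale B / Real.pi) * φ 0 := by
    norm_num
  rw [hval]
  positivity

/-- **The gauged members of a curve of admissible data are admissible** (breathing of the admissible
datum `H (ρ c)`: `AFEnd.breatheCurve_mem_admissibleVacuumData`). [cite: BartnikIsenberg2004, §2] -/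
theorem breatheQuad_mem_admissibleVacuumData [SecondCountableTopology X] [ConnectedSpace X]
    (hadm : ∀ c, H c ∈ admissibleVacuumData X) (c : EuclideanSpace ℝ (Fin 1)) :
    AFEnd.breatheFamily B (H (EuclideanSpace.single 0 ((c 0) ^ 2))) (c 0) ∈ admissibleVacuumData X :=
  AFEnd.breatheCurve_mem_admissibleVacuumData B _ (hadm _) c

/-- **Breathing-invariant properties pass to the gauged members off `0`**: if `P` is invariant under
the breathing deformations `d ↦ E_t(d)` of `B` and the members of `H` off `0` satisfy `P`, so do the
members of the gauged family off `0` (`ρ c ≠ 0` for `c ≠ 0`). [folklore] -/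
theorem breatheQuad_of_breatheInvariant {P : InitialDataSet (𝓡 3) X → Prop}
    (hP : ∀ (d : InitialDataSet (𝓡 3) X) (t : ℝ), P d → P (AFEnd.breatheFamily B d t))
    (hgood : ∀ c ≠ 0, P (H c)) (c : EuclideanSpace ℝ (Fin 1)) (hc : c ≠ 0) :
    P (AFEnd.breatheFamily B (H (EuclideanSpace.single 0 ((c 0) ^ 2))) (c 0)) :=
  hP _ (c 0) (hgood _ (InitialDataSet.quadAxis_ne_zero hc))

end Gauged

end AFEnd

namespace InitialDataSet

variable {X : Type} [TopologicalSpace X] [ChartedSpace E3 X] [IsManifold (𝓡 3) ∞ X] [T2Space X]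
  [SecondCountableTopology X] [ConnectedSpace X]

/-- **THE GAUGE-BORNE UPGRADE: tame witness curves need neither injectivity nor immersion.** Let `P`
be a property of data invariant under the breathing deformations of the end `e`
(`∀ B d t, P d → P (E_t d)`), and let `H` be a TAME curve of admissible data on `e` whose members off
`0` satisfy `P`. Then there are an end `e'` (a collared restriction of `e`) and a tame, INJECTIVE,
IMMERSED curve `F'` of admissible data with `F' 0 = H 0` whose members off `0` satisfy `P`: the gauged
family of `H` on a breathing ball far out on `e` (`TameGaugedFamily.lean`: tame on the collar;
`isImmersedAtZero_breatheQuad`; `breatheQuad_mem_admissibleVacuumData`; `breatheQuad_of_breatheInvariant`),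
made injective on a window by `exists_tameCurve_of_localWindow`. This renders Christodoulou's remark
that genericity is a statement about a fixed space of data up to gauge (CQG 16 (1999), p. A24) as the
device that turns ANY tame curve construction into a legal witness. [cite: Christodoulou1999, p. A24] -/
theorem exists_tameCurve_upgrade_of_breatheInvariant {e : AFEnd X} {P : InitialDataSet (𝓡 3) X → Prop}
    (hP : ∀ {z₀ : E3} {r : ℝ} (B : e.BreathingData z₀ r) (d : InitialDataSet (𝓡 3) X) (t : ℝ),
      P d → P (AFEnd.breatheFamily B d t))
    {H : EuclideanSpace ℝ (Fin 1) → InitialDataSet (𝓡 3) X} (hH : IsTameDataFamily e 1 H)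
    (hadm : ∀ c, H c ∈ admissibleVacuumData X) (hgood : ∀ c ≠ 0, P (H c)) :
    ∃ (e' : AFEnd X) (F' : EuclideanSpace ℝ (Fin 1) → InitialDataSet (𝓡 3) X),
      IsTameDataFamily e' 1 F' ∧ F' 0 = H 0 ∧ Injective F' ∧ IsImmersedAtZero 1 F' ∧
        (∀ c, F' c ∈ admissibleVacuumData X) ∧ ∀ c ≠ 0, P (F' c) := by
  -- a breathing ball far out on the end (as in `exists_tame_selfWitness`)
  set z₀ : E3 := (e.R + 3) • EuclideanSpace.single (0 : Fin 3) (1 : ℝ) with hz₀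
  have hz₀n : ‖z₀‖ = e.R + 3 := by
    rw [hz₀, norm_smul, PiLp.norm_single, norm_one, mul_one,
      Real.norm_of_nonneg (by linarith [e.R_pos])]
  have B : e.BreathingData z₀ 1 := ⟨one_pos, by rw [hz₀n]; linarith⟩
  have hR₁ : e.R < e.R + 1 := by linarith
  -- the gauged family: tame on the collar, immersed at `0`, admissible, `P` off `0`
  have h2 := AFEnd.isTameDataFamily_restrict_breatheQuad B H hH hR₁
  have h3 := AFEnd.isImmersedAtZero_breatheQuad B H hH.1
  obtain ⟨F', hF', hF'0, hinj, himm, hadm', hgood'⟩ :=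
    exists_tameCurve_of_localWindow (𝓓 := admissibleVacuumData X) (P := P) h2 h3 zero_lt_one
      (fun c _ ↦ AFEnd.breatheQuad_mem_admissibleVacuumData B H hadm c)
      (fun c hc _ ↦ AFEnd.breatheQuad_of_breatheInvariant B H (hP B) hgood c hc)
  exact ⟨e.restrict hR₁.le, F', hF', hF'0.trans (AFEnd.breatheQuad_zero B H), hinj, himm, hadm', hgood'⟩

/-- **Tame codimension one from merely TAME curves** (breathing-invariant exceptional sets): if `P` is
invariant under the breathing deformations of every end and through every `d ∈ 𝓔 := {d admissible | ¬ P d}`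
passes a tame curve of admissible data with `H 0 = d` whose members off `0` satisfy `P`, then `𝓔` has
tame codimension at least `1` in `admissibleVacuumData X` — injectivity and immersion are supplied by
`exists_tameCurve_upgrade_of_breatheInvariant`. [cite: Christodoulou1999, p. A24] -/
theorem hasTameCodimAtLeastIn_one_of_tameCurves {P : InitialDataSet (𝓡 3) X → Prop}
    (hP : ∀ (e : AFEnd X) {z₀ : E3} {r : ℝ} (B : e.BreathingData z₀ r) (d : InitialDataSet (𝓡 3) X)
      (t : ℝ), P d → P (AFEnd.breatheFamily B d t))
    (h : ∀ d ∈ admissibleVacuumData X, ¬ P d →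
      ∃ (e : AFEnd X) (H : EuclideanSpace ℝ (Fin 1) → InitialDataSet (𝓡 3) X),
        IsTameDataFamily e 1 H ∧ H 0 = d ∧ (∀ c, H c ∈ admissibleVacuumData X) ∧ ∀ c ≠ 0, P (H c)) :
    HasTameCodimAtLeastIn (admissibleVacuumData X) {d ∈ admissibleVacuumData X | ¬ P d} 1 := by
  intro d hd
  obtain ⟨e, H, hH, hH0, hadm, hgood⟩ := h d hd.1 hd.2
  obtain ⟨e', F', hF', hF'0, hinj, himm, hadm', hgood'⟩ :=
    exists_tameCurve_upgrade_of_breatheInvariant (fun B d t hd ↦ hP e B d t hd) hH hadm hgood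
  exact ⟨e', F', hF', himm, hF'0.trans hH0, hinj, hadm', fun c hc hmem ↦ hmem.2 (hgood' c hc)⟩

/-- **Tame Christodoulou genericity (codimension one) from merely TAME curves.** A property `P` of
admissible data, invariant under the breathing deformations of every end, is generic in the sense of
Christodoulou with tame codimension `1` in `admissibleVacuumData X` as soon as through every admissible
datum failing `P` passes SOME tame curve of admissible data — neither injective nor immersed — whose
members off `0` satisfy `P`. With `P` the settling clause of the final state conjecture (breathing
invariant by re-indexing of maximal developments along diffeomorphisms) this removes injectivity and
immersion from every witness obligation of the conjecture. [cite: Christodoulou1999, p. A24] -/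
theorem isTameChristodoulouGeneric_one_of_tameCurves {P : InitialDataSet (𝓡 3) X → Prop}
    (hP : ∀ (e : AFEnd X) {z₀ : E3} {r : ℝ} (B : e.BreathingData z₀ r) (d : InitialDataSet (𝓡 3) X)
      (t : ℝ), P d → P (AFEnd.breatheFamily B d t))
    (h : ∀ d ∈ admissibleVacuumData X, ¬ P d →
      ∃ (e : AFEnd X) (H : EuclideanSpace ℝ (Fin 1) → InitialDataSet (𝓡 3) X),
        IsTameDataFamily e 1 H ∧ H 0 = d ∧ (∀ c, H c ∈ admissibleVacuumData X) ∧ ∀ c ≠ 0, P (H c)) :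
    IsTameChristodoulouGeneric (admissibleVacuumData X) P 1 :=
  hasTameCodimAtLeastIn_one_of_tameCurves hP h

end InitialDataSet

end Literature.Geometry.Lorentzian

end
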